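import Mathlib

/-!
# `Balaban1983to89.B11SectFCoverage` — [Balaban1985Variational] Sect. F, first case: the cube-geometry clause
«□̃ ⊂ Ω_{k−1}» of its source [Balaban1985RegularSpaces] p. 98, against the minimal determining sets of
[Balaban1988ConvergentRenormalizationIII] p. 256 — a d-dimensional, norm-independent FLAT-FACE WITNESS
(v2.1 = docstring-only DOCFIX over v2 p186942: every declaration byte-identical; see «v2.1 CHANGES» at the end of
this header)

CITATION HEADER (lean-in-tree rule 2026-08-18).  Sources: T. Bałaban, *The variational problem and background fields
in renormalization group method for lattice gauge theories*, Commun. Math. Phys. **102**, 277–309 (1985),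
doi:10.1007/bf01229381 (cell paper B11, held `paper:balaban1985-cmp102-variational-background`, journal page = PDF
page + 276); its reference [6] = T. Bałaban, *Averaging operations for lattice gauge theories* II = *Spaces of regular
gauge field configurations on a lattice and gauge fixing conditions*, Commun. Math. Phys. **99**, 75–102 (1985) (cell
paper B8); the consumer T. Bałaban, *Convergent renormalization expansions for lattice gauge theories*, Commun. Math.
Phys. **119**, 243–285 (1988) (cell paper B14 = [III] of the 1987–89 series).  Quotations below are from the page
renders `HOME/b2b-balaban-ref1/pages/1985-cmp102-variational-background/…-p024…p028-x2.png` (B11 pp. 300–304),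
`…/1985-cmp99-regular-spaces-gauge-fixing/…-p003-x2.png`, `…-p024-x2.png` (B8 pp. 77, 98) and
`…/1988-cmp119-convergent-renormalization/…-p014-x2.png` (B14 p. 256), READ AS IMAGES by the authoring seat
(b2b-balaban-b11-g20).  Mathlib-only; modifies nothing; imports nothing of the cell (the general cube-layer
toolkit `…Balaban1983to89.B14DomainGeom` (pv02: `Pt`, `Within`, `enl`, `innerN`) treats the domains Ω_j, Λ_j of B14
(2.1)–(3.20), not the minimal determining sets 𝐁_j(Ω); it is not needed here — half-spaces suffice).  Cell records: GAPS G-B11-F6,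
C-B11-G19a (b11-g19), C-B11-G20a (this leaf, v2), C-B11-G21a (v2.1); cross-read of v2: GAPS C-r2.73 (b2b-balaban-r2-g27,
verdict ok, objections 0); FINAL-STATEMENT §5 (e) ⟦v19.10 KERNEL POINTER⟧; SMALLNESS §2 item 2; REFEREE R58.1(d).

THE PRINTED SENTENCES USED (verbatim).
* B11 p. 278 [PDF 2], the space (2) (= 𝔘_k({Ω_j}, ε₀)): *«|U(∂p) − 1| = |(∂U)(p) − 1| < ε₀L^{−2j} = ε₀η²(Lʲη)^{−2}
  for p ∈ Ω_j, j = 0, 1, …, k, |(D*_U∂U)(b)| < ε₀L^{−2j}(Lʲη)^{−1} = ε₀η²(Lʲη)^{−3} for b ∈ Ω_j,»* (η = L^{−k}, (5)).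
* B11 p. 279 [PDF 3]: *«The constants a₀, a₁, B₃, depend on d and L only»*; *«The first step of the proof, for k = 1,
  will be covered by the proof of a general case.»*
* B11 p. 300 [PDF 24], Sect. F ¶2 (three omissions, each marked «[…]»; otherwise verbatim): *«Let us take a cube □
  intersecting Ω_j but not Ω_{j+1}, of a size 2MLʲη. […] In both cases M ≧ R₁M₁ and we assume that M is a multiple
  of R₁M₁, i.e. M = M′R₁M₁, M′ is an integer.  We will use the notations and the results of the Sect. F from [6], so
  we refer the reader for explanations to that paper.  For a given □ we construct the sequence of cubes {□_n}, and
  the cube □̃.  Let us recall that  □₀ ⊃ □₁ ⋯ ⊃ □_j ⊃ □, dist(□_{n+1}, □_nᶜ) = R₁M₁Lⁿη, n = 0, 1, …, j, (144)  and □̃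
  is a cube with dist(□, □̃ᶜ) = 2R₁M₁Lʲη.  Thus □_j = □′_j ∪ □″_j, □′_j ⊂ B^{j−1}(Λ_{j−1}), □″_j ⊂ Bʲ(Λ_j) and □̃ ⊂
  B^{j−1}(Λ_{j−1}) ∪ Bʲ(Λ_j) ⊂ Ω_{j−1}.  For simplicity of notations we assume that j = k, a general case can be
  obtained by obvious rescalings. […] The configuration U_k belongs to the space (2) with ε₀ sufficiently small, hence
  U′_k satisfies the conditions (2) on □̃ with L²ε₀η² on the right-hand side.»*  (First case: M = R₁M₁.  The v2
  header carried here an unmarked splice «so we have the sequence of cubes», «notation» for «notations», and the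
  symbolic paraphrase «Because U_k ∈ 𝔘_k({Ω_j}, ε₀), so …» of the last sentence — misquotations m1–m3 of the v2
  cross-read, content-neutral, repaired here.)
* B11 p. 302 [PDF 26]: (155) *«V₁ = e^{iB} with |B| < 18d²L³Mε₀,»*; p. 303 [PDF 27]: (162) *«B₃ = 72d³L³B₀ sup_{ℭ_k}
  sup_{y₁} Σ_{y₂∈ℭ_k} e^{−1/2δ₀d(y₁,y₂)}(d(y₁, y₂) + 1)(L^{j₂}η)^{−1}.»* and *«It follows from the inequalities
  (2.47)–(2.51) of [3] that B₃ depends on d and L only.»*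
* B11 p. 301 [PDF 25]: (145) *«|Ū′ᵏ_k(x,x′) − 1| < |x − y|2L²ε₀ ≦ 4d(M + R₁M₁)L²ε₀ ≦ 8dL²Mε₀ for ⟨x,x′⟩ ⊂ □̃^{(k)}»*;
  (148) *«ℭ_k = ⋃ Λ′_j, Λ′₀ = □₁ᶜ ∩ □̃, Λ′_j = □_j^{(j)}∖□_{j+1}^{(j)}, j = 1, …, k − 2, Λ′_{k−1} = (□_{k−1}^{(k−1)}∖□_k^{(k−1)})
  ∪ □′_k^{(k−1)}, Λ′_k = □″_k^{(k)}»*; (150) *«U′_k ∈ 𝔘_k({Ω′_j}, ε₀) ∩ 𝔅_k(ℭ_k, V″) ∩ Ax_k(ℭ_k, 1), where Ω′_j = □_j,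
  j = 0, …, k − 1, Ω′_k = □″_k»*; (151) *«|V″ − 1| < 9dL²Mε₀ − ε₀ on ℭ_k»*.
* B11 p. 302 [PDF 26], last ¶: *«To prove that U_k belongs to the space (8) we have to prove the inequalities (2) with
  ε₀ = B₃ε₁.  They are local, and for a plaquette p, or a bond b, we take a unit cube Δ₀ ⊂ Bʲ(Λ_j) containing p or b.
  The cube Δ₀ is contained in a big cube of the size 2R₁M₁Lʲη and we take □ as this big cube.»*
* B11 p. 303 [PDF 27]: *«It implies that |V′₁(∂p) − 1| < ε₁ for p ∈ □″_k^{(k)}, and |V′₁(∂p) − 1| < 2L²ε₁ for p ⊂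
  □′_k^{(k)}»*; (160) *«|B(x,x′)| < (8d²L² + 4L²|x − y|)ε₁ for ⟨x,x′⟩ ∈ □′_k^{(k−1)} ∪ □″_k^{(k)}»*.
* B11 p. 304 [PDF 28]: *«The cube Δ₀ is an arbitrary cube Δ(y) = Bʲ(y), if y ∈ Λ_j, hence U_k belongs to the space
  (2) with max{B₃ε₁, ½ε₀} instead of ε₀. … If ½ε₀ > B₃ε₁, then we apply again the whole reasoning with ½ε₀ instead
  of ε₀.»*
* B8 p. 77 [PDF 3], (1.4): *«Ω_j = Bʲ(Ω_j^{(j)}), Ω_j is a sum of cubes of a size M₁Lʲη, (Lʲη)⁻¹dist(Ω_jᶜ, Ω_{j+1})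
  > RM₁.»*; p. 98 [PDF 24]: *«We cover □₀ by a smallest family of cubes of the size R₁M₁.  A sum of these cubes is a
  cube which we denote by □̃.  A distance of its boundary to □ is equal to 2R₁M₁.  We assume that RM is bigger than
  R₁M₁, for example L⁻¹RM > 2dR₁M₁, thus we have □̃ ⊂ Ω_{k−1}.»* — the clause that B11's hypothesis (1) p. 277
  *«R ≧ R₁»* suppresses (cell GAPS G-B11-F6).
* B14 p. 256 [PDF 14]: *«Consider a domain Ω such that it is a union of M₁-cubes in the lattice T_ξ, ξ = L⁻ʲ.  For this
  domain we build a minimal determining set with a support in Ω, or a sequence of maximal domains Ω = Ω₀ ⊃ Ω₁ ⊃ … ⊃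
  Ω_j such that Ω_n is a union of LⁿξM₁-cubes, and dist(Ω_n, Ωᶜ_{n−1}) ≧ LⁿξM₁, n = 1, …, j (the distance is for the
  lattice T_ξ).  It is easy to see that dist(Ω_j, Ωᶜ) ≦ 2M₁, or Ω^{∼−2} ⊂ Ω_j, where the operation ∼ is taken for
  M₁-cubes.  We denote this determining set by 𝐁_j(Ω)»*, and *«we will use all the results of [15]»* ([15] = B11).

WHAT IS KERNEL-CHECKED HERE (elementary lattice geometry in ℤ^d, every d; FINE-LATTICE UNITS ξ ↦ 1, so a level-n
M₁-cube has side LⁿM₁ and the collar of (144) at the top level j is c = 2R₁M₁Lʲ; a := L^{j−1}M₁):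
(1) `not_subset_of_witness` — for ANY sets: if □̃ ⊇ the strict sup-collar of width c of □ (this is what «dist(□, □̃ᶜ)
    = c» gives, in the ℓ¹, ℓ² and ℓ^∞ lattice metrics alike, □̃ being a cube) and □ ∋ v, then the site v − (c−1)e_i
    lies in □̃; so □̃ ⊄ Ω′ as soon as that site is outside Ω′.
(2) `sectF_tilde_not_subset_prev` — ON A FLAT FACE of Ω (normal e_i, face coordinate 0; Ω, Ω_{j−1}, Ω_j are the
    half-spaces {x_i ≧ 0} ⊃ {x_i ≧ t_{j−1}} ⊃ {x_i ≧ t_j} there): from the PRINTED t_j ≦ 2LʲM₁ («Ω^{∼−2} ⊂ Ω_j») and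
    t_{j−1} ≧ L^{j−1}M₁ − 1 (the printed separations dist(Ω_n, Ωᶜ_{n−1}) ≧ LⁿξM₁ summed over n = 1, …, j − 1 — a
    non-empty sum, i.e. j ≧ 2 —, either site convention), for every R₁ ≧ 1, L ≧ 1 and L^{j−1}M₁ ≧ 3 (with j ≧ 2:
    e.g. L ≧ 2, M₁ ≧ 2), and every top-layer block Δ₀ = Bʲ(y) ⊂ Ω_j adjacent to the face (a site v ∈ Δ₀ ⊂ □ with
    v_i = t_j): □̃ ⊄ Ω_{j−1} — the printed clause fails; `sectF_tilde_reaches_frozen_layer`: □̃ even meets {x_i < t₁} ⊃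
    Λ₀ ∪ Ωᶜ for any t₁ ≧ 2; `sectF_tilde_exits_Omega`: for R₁ ≧ 2, □̃ ⊄ Ω.  THE CASE j = 1 (it occurs: p. 279 «The
    first step of the proof, for k = 1, will be covered by the proof of a general case», p. 280 «for k = 1 … we take
    simply U₀ = V₀»; then Ω_{j−1} = Ω₀ = Ω and t₀ = 0, so `hF2` is unavailable for M₁ ≧ 2): the statement there is
    `sectF_tilde_exits_Omega` — for R₁ ≧ 2, □̃ ⊄ Ω = Ω₀ = Ω_{j−1}, the same clause failing —, while for j = 1, R₁ = 1
    only the contact `sectF_tilde_reaches_frozen_layer` is asserted (witness coordinate ≦ 1) and NO claim □̃ ⊄ Ω₀ is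
    made.  (The v2 docstring of `sectF_tilde_not_subset_prev` read «(e.g. M₁ ≥ 3, or M₁ ≥ 2 ≤ L with j ≥ 2)»; the
    hypothesis `hF2` itself presupposes j ≧ 2 — author-side DOCFIX #1, journal INFO 2026-08-19T11:02:59Z, whose clause
    «the first step is [13, 14]» is withdrawn: p. 279 says the opposite.)
(3) `tFlat_aligned` / `tFlat_sep` / `tFlat_maximal` — the maximal flat nest is EXACTLY t₀ = 0, t₁ = LM₁, t_n = 2LⁿM₁
    (n ≧ 2) for L ≧ 2 (grid alignment, printed separation, maximality certificate, for any `t : ℕ → ℤ` with these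
    values — the leaf is THEOREM-ONLY, no definitions), so B14's «≦ 2M₁» is ATTAINED on flat faces and the sub-top
    layer is 2(L−1)·L^{j−1}M₁ thick (`tFlat_layer`); `realized_shortfall` / `needed_gt_layer`: R₁·L·(that layer) =
    (L−1)·(needed collar 2R₁LʲM₁), layer < needed.
(4) `kappa_needed` — the precise sense of the cell's «short by a factor ≥ 2 for every parameter choice» (FINAL-STATEMENT
    §5 (e) ⟦v19.8⟧): a maximal nest with separation constant κ (dist(Ω_n, Ωᶜ_{n−1}) ≧ κ·LⁿξM₁; printed κ = 1) has its
    sub-top layer < (κ+1)·LʲM₁ thick at a flat face (`layer_lt_of_maximal`), the clause needs ≧ 2R₁·LʲM₁ there, hence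
    κ ≧ 2R₁ ≧ 2.  ON `hneed` («layer ≧ 2R₁u», u = LʲM₁): the witness of (2) alone forces only layer ≧ 2R₁u − 1 (the site
    v − (2R₁u − 1)e_i must not drop below t_{j−1}); «≧ 2R₁u − 1 ⇔ ≧ 2R₁u» holds BY GRID ALIGNMENT — t_{j−1}, t_j and
    2R₁u are multiples of L^{j−1}M₁ ≧ 2 («Ω_n is a union of LⁿξM₁-cubes») —; without alignment only κ ≧ 2R₁ − 1 would
    follow, which the printed κ = 1, R₁ = 1 does not violate.  Immaterial for the record (the main witness (2) covers
    every R₁ ≧ 1 from the printed numbers and `needed_gt_layer` the realized nest); reading remark ρ-F6a of the v2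
    cross-read, adopted.
WHY TOP LEVEL AND OUTER CLAUSE ONLY (cell reading of which printed step consumes which clause — a READING, not a
kernel fact): the outer inclusion «□̃ ⊂ Ω_{j−1}» is what (145)–(146), (151), (155) and (160)–(161) consume through the
one-level factor L² (conditions (2) give ε₀L^{−2m} on Ω_m; inside □̃ on layers m ≦ j − 2 the level-j smallness
degrades by L^{2(j−m)}); the two-piece split «□_j = □′_j ∪ □″_j» is consumed by (147)–(148) and (160).  LOCATED
EDGE (v2 cross-read, adopted; pages re-read as images by the v2.1 seat): the «L²» of p. 300's last sentence IS (2)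
p. 278 at j = k − 1 — on Ω_{k−1} the plaquette bound reads ε₀L^{−2(k−1)} = L²ε₀η² —, i.e. exactly the use of «□̃ ⊂
Ω_{k−1}»; it travels (145)–(146) → (151) → (155) «|B| < 18d²L³Mε₀» → the ℭ_k∖□_k sum of (161) → (162)–(163), and B₃
«depends on d and L only» (p. 279, p. 303), so a k-dependent loss L^{2(k−m)} from layers m ≦ k − 2 inside □̃ is not
absorbable into the printed constants.  At the top
level j = k there is no Ω_{k+1}, so the inner side of p. 300's sentence is vacuous and the witness isolates B8's own
clause «□̃ ⊂ Ω_{k−1}».  The gen-19 scratch model `HOME/b2b-balaban-b11-g19/SectFCoverage.lean` (7fee10782ef83cfc)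
reached the same necessity through the inner collar and level-(j+1) cubes; the present route needs neither, and no
metric factor c_d (distances to a flat face agree in all ℓᵖ).
MODEL DISCLAIMER.  Nothing of the papers' ANALYSIS is formalised and no statement of B8, B11 or B14 is asserted or
refuted: the theorems exhibit that the PRINTED localisation of B11 Sect. F (first case = Prop. 8, whose coverage
sentence p. 304 ranges over every y ∈ Λ_j), with its printed source clause, does not place □̃ inside Ω_{j−1} at
top-layer boundary blocks of B14's minimal determining sets; whether an unprinted re-localisation reaches that
geometry (cell (R3)) or the sets are thickened (cell (R2⁺), κ ≧ 2R₁: constants only) is not decided here.  NOT Theorem 1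
of B11, NOT B12 (iv), NOT summit progress.
v2.1 CHANGES (docstrings only; b2b-balaban-b11-g21, 2026-08-19; renders of B11 pp. 278, 279, 280, 300, 302, 303 READ
AS IMAGES by this seat): (i) the p. 300 quotation made verbatim with marked omissions (cross-read items m1–m3);
(ii) new verbatim bullets p. 278 (2), p. 279 (constants; k = 1), p. 302 (155), p. 303 (162) + last line; (iii) item (2)
and the docstring of `sectF_tilde_not_subset_prev`: `hF2` presupposes j ≧ 2, the case j = 1 stated through
`sectF_tilde_exits_Omega` / `sectF_tilde_reaches_frozen_layer`; (iv) item (4) and `kappa_needed`: the grid-alignment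
clause (ρ-F6a); (v) the located edge for the one-level factor L².  Cell records GAPS C-B11-G21a; C-r2.73.
-/

namespace Literature.MathematicalPhysics.QuantumFieldTheory.Balaban1983to89.B11SectFCoverage

/-! ## §1  Sites of ℤ^d (`Fin d → ℤ`), flat half-spaces `{x | t ≤ x i}`, strict sup-collars, the outward witness

No definitions are introduced (the leaf is theorem-only): Ω, Ω_{j−1}, Ω_j near a flat face with inner normal `e_i` are
the half-spaces `{x | 0 ≤ x i} ⊃ {x | t_{j−1} ≤ x i} ⊃ {x | t_j ≤ x i}`; the strict sup-collar of width `c` of □ is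
`{x | ∃ y ∈ □, ∀ k, |x k − y k| < c}` ((144) «dist(□, □̃ᶜ) = 2R₁M₁Lʲη» puts it inside □̃ for c = 2R₁M₁Lʲ fine units, in
the ℓ¹, ℓ² and ℓ^∞ lattice metrics alike, □̃ being a cube); the outward witness is `Function.update v i (v i − (c−1))`. -/

/-- The `i`-coordinate of the outward witness `v − (c−1)e_i`. [folklore] -/
theorem push_self {d : ℕ} (v : Fin d → ℤ) (i : Fin d) (c : ℤ) :
    Function.update v i (v i - (c - 1)) i = v i - (c - 1) := by
  simp

/-- The other coordinates of the witness are those of `v`. [folklore] -/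
theorem push_ne {d : ℕ} (v : Fin d → ℤ) (i : Fin d) (c : ℤ) {k : Fin d} (hk : k ≠ i) :
    Function.update v i (v i - (c - 1)) k = v k := by
  simp [hk]

/-- The witness lies in the strict sup-collar of width `c ≥ 1` of any set containing `v`. [folklore] -/
theorem push_mem_strictCollar {d : ℕ} (S : Set (Fin d → ℤ)) {v : Fin d → ℤ} (hv : v ∈ S) (i : Fin d) {c : ℤ}
    (hc : 1 ≤ c) :
    Function.update v i (v i - (c - 1)) ∈ {x : Fin d → ℤ | ∃ y ∈ S, ∀ k, |x k - y k| < c} := by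
  refine ⟨v, hv, fun k => ?_⟩
  by_cases hk : k = i
  · subst hk
    rw [push_self, show v k - (c - 1) - v k = -(c - 1) by ring, abs_neg, abs_of_nonneg (by linarith)]
    linarith
  · rw [push_ne v i c hk, sub_self, abs_zero]
    linarith

/-- The witness is outside the half-space `{x | t ≤ x i}` as soon as `v i − (c−1) < t`. [folklore] -/
theorem push_not_mem_half {d : ℕ} (v : Fin d → ℤ) (i : Fin d) (c t : ℤ) (h : v i - (c - 1) < t) :
    Function.update v i (v i - (c - 1)) ∉ {x : Fin d → ℤ | t ≤ x i} := by
  simp only [Set.mem_setOf_eq, push_self, not_le]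
  exact h

/-- ABSTRACT OBSTRUCTION (any `d`, any sets).  If □̃ (`T`) contains the strict `c`-collar of □ (`S`), □ ∋ `v`, and the
site `v − (c−1)e_i` is outside Ω′, then □̃ ⊄ Ω′. [folklore] -/
theorem not_subset_of_witness {d : ℕ} {S T Ω' : Set (Fin d → ℤ)} {v : Fin d → ℤ} {i : Fin d} {c : ℤ}
    (hv : v ∈ S) (hc : 1 ≤ c) (hT : {x : Fin d → ℤ | ∃ y ∈ S, ∀ k, |x k - y k| < c} ⊆ T)
    (hw : Function.update v i (v i - (c - 1)) ∉ Ω') : ¬ T ⊆ Ω' :=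
  fun h => hw (h (hT (push_mem_strictCollar S hv i hc)))

/-! ## §2  Flat-face arithmetic from the printed numbers (fine units; `a` = L^{j−1}M₁, collar c = 2R₁·(L·a)) -/

/-- The witness coordinate lies below t_{j−1}: t_j − (c − 1) ≤ 2La − 2R₁La + 1 ≤ 1 < a − 1 ≤ t_{j−1}. [folklore] -/
theorem witness_lt_prev (L a R₁ tj tjm1 : ℤ) (hL : 1 ≤ L) (ha : 3 ≤ a) (hR : 1 ≤ R₁)
    (hF1 : tj ≤ 2 * (L * a)) (hF2 : a - 1 ≤ tjm1) :
    tj - (2 * R₁ * (L * a) - 1) < tjm1 := by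
  have hLa : 0 ≤ L * a := mul_nonneg (by linarith) (by linarith)
  have h : L * a ≤ R₁ * (L * a) := le_mul_of_one_le_left hLa hR
  linarith

/-- The witness coordinate lies below any t₁ ≥ 2 (so □̃ meets {x_i < t₁} ⊃ Λ₀ ∪ Ωᶜ on that face). [folklore] -/
theorem witness_lt_two (L a R₁ tj t1 : ℤ) (hL : 1 ≤ L) (ha : 0 ≤ a) (hR : 1 ≤ R₁)
    (hF1 : tj ≤ 2 * (L * a)) (ht1 : 2 ≤ t1) :
    tj - (2 * R₁ * (L * a) - 1) < t1 := by
  have hLa : 0 ≤ L * a := mul_nonneg (by linarith) ha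
  have h : L * a ≤ R₁ * (L * a) := le_mul_of_one_le_left hLa hR
  linarith

/-- For R₁ ≥ 2 the witness coordinate is negative (□̃ leaves Ω = {x_i ≥ 0}). [folklore] -/
theorem witness_lt_zero (L a R₁ tj : ℤ) (hL : 1 ≤ L) (ha : 1 ≤ a) (hR : 2 ≤ R₁)
    (hF1 : tj ≤ 2 * (L * a)) :
    tj - (2 * R₁ * (L * a) - 1) < 0 := by
  have hLa : 1 ≤ L * a := by nlinarith
  have h : 2 * (L * a) ≤ R₁ * (L * a) := mul_le_mul_of_nonneg_right hR (by linarith)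
  linarith

/-- The collar width is positive: 1 ≤ c = 2R₁La. [folklore] -/
theorem one_le_collar (L a R₁ : ℤ) (hL : 1 ≤ L) (ha : 1 ≤ a) (hR : 1 ≤ R₁) : 1 ≤ 2 * R₁ * (L * a) := by
  have hLa : 1 ≤ L * a := by nlinarith
  nlinarith

/-! ## §3  The witness in ℤ^d: B14's minimal sets violate «□̃ ⊂ Ω_{j−1}» at top-layer boundary blocks -/

/-- **Main witness.**  Flat face of Ω with inner normal `e_i` at coordinate 0; fine units; `a = L^{j−1}M₁`.
PRINTED INPUTS: `hF1` = B14 p. 256 «Ω^{∼−2} ⊂ Ω_j» (t_j ≤ 2LʲM₁ = 2La); `hF2` = the printed separations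
«dist(Ω_n, Ωᶜ_{n−1}) ≧ LⁿξM₁» summed over n = 1, …, j − 1 (t_{j−1} ≥ L^{j−1}M₁ − 1, either site convention; the sum is
non-empty iff j ≥ 2 — for j = 1, where Ω_{j−1} = Ω and t₀ = 0, use `sectF_tilde_exits_Omega` (R₁ ≥ 2); nothing is
claimed for j = 1, R₁ = 1); `h144` = B11 (144) «dist(□, □̃ᶜ) = 2R₁M₁Lʲη» (the strict
sup-collar of width 2R₁La of □ lies in □̃); `hv`, `hvi` = the block Δ₀ = Bʲ(y) ⊂ □ of p. 302/p. 304 adjacent to the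
face (a site of it has i-coordinate t_j).  CONCLUSION: the printed clause «□̃ ⊂ … ⊂ Ω_{j−1}» (B11 p. 300; B8 p. 98
«thus we have □̃ ⊂ Ω_{k−1}») FAILS — □̃ ⊄ Ω_{j−1} = {x | t_{j−1} ≤ x i} — for every R₁ ≥ 1, L ≥ 1 and
L^{j−1}M₁ ≥ 3 (j ≥ 2 being presupposed by `hF2`: e.g. L ≥ 2, M₁ ≥ 2).  Norm-independent: distances to a flat face
agree in ℓ¹, ℓ², ℓ^∞.  (A kernel statement ABOUT the printed geometry; nothing of the papers is asserted.) [folklore] -/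
theorem sectF_tilde_not_subset_prev {d : ℕ} (i : Fin d) (L a R₁ tj tjm1 : ℤ)
    (hL : 1 ≤ L) (ha : 3 ≤ a) (hR : 1 ≤ R₁) (hF1 : tj ≤ 2 * (L * a)) (hF2 : a - 1 ≤ tjm1)
    {box tilde : Set (Fin d → ℤ)} {v : Fin d → ℤ} (hv : v ∈ box) (hvi : v i = tj)
    (h144 : {x : Fin d → ℤ | ∃ y ∈ box, ∀ k, |x k - y k| < 2 * R₁ * (L * a)} ⊆ tilde) :
    ¬ tilde ⊆ {x : Fin d → ℤ | tjm1 ≤ x i} := by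
  refine not_subset_of_witness (i := i) hv (one_le_collar L a R₁ hL (by linarith) hR) h144 ?_
  apply push_not_mem_half
  rw [hvi]
  exact witness_lt_prev L a R₁ tj tjm1 hL ha hR hF1 hF2

/-- Same data: □̃ meets `{x | x i < t₁}` for every t₁ ≥ 2 — with t₁ = LM₁ (the face of Ω₁) this is the frozen layer
Λ₀ = Ω∖Ω₁ together with Ωᶜ: the cube of the local problem reaches all the way down the nest. [folklore] -/
theorem sectF_tilde_reaches_frozen_layer {d : ℕ} (i : Fin d) (L a R₁ tj t1 : ℤ)
    (hL : 1 ≤ L) (ha : 1 ≤ a) (hR : 1 ≤ R₁) (hF1 : tj ≤ 2 * (L * a)) (ht1 : 2 ≤ t1)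
    {box tilde : Set (Fin d → ℤ)} {v : Fin d → ℤ} (hv : v ∈ box) (hvi : v i = tj)
    (h144 : {x : Fin d → ℤ | ∃ y ∈ box, ∀ k, |x k - y k| < 2 * R₁ * (L * a)} ⊆ tilde) :
    ¬ tilde ⊆ {x : Fin d → ℤ | t1 ≤ x i} := by
  refine not_subset_of_witness (i := i) hv (one_le_collar L a R₁ hL ha hR) h144 ?_
  apply push_not_mem_half
  rw [hvi]
  exact witness_lt_two L a R₁ tj t1 hL (by linarith) hR hF1 ht1

/-- Same data with R₁ ≥ 2: □̃ ⊄ Ω = `{x | 0 ≤ x i}` — the cube of the local problem leaves the support of 𝐁_j(Ω).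
[folklore] -/
theorem sectF_tilde_exits_Omega {d : ℕ} (i : Fin d) (L a R₁ tj : ℤ)
    (hL : 1 ≤ L) (ha : 1 ≤ a) (hR : 2 ≤ R₁) (hF1 : tj ≤ 2 * (L * a))
    {box tilde : Set (Fin d → ℤ)} {v : Fin d → ℤ} (hv : v ∈ box) (hvi : v i = tj)
    (h144 : {x : Fin d → ℤ | ∃ y ∈ box, ∀ k, |x k - y k| < 2 * R₁ * (L * a)} ⊆ tilde) :
    ¬ tilde ⊆ {x : Fin d → ℤ | 0 ≤ x i} := by
  refine not_subset_of_witness (i := i) hv (one_le_collar L a R₁ hL ha (by linarith)) h144 ?_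
  apply push_not_mem_half
  rw [hvi]
  exact witness_lt_zero L a R₁ tj hL ha hR hF1

/-! ## §4  The maximal flat nest of B14 p. 256 is exactly t₀ = 0, t₁ = LM₁, t_n = 2LⁿM₁ (n ≥ 2)

Face coordinates of the maximal nest along a flat face of Ω at 0 (fine units; continuum convention
dist(Ω_n, Ωᶜ_{n−1}) = t_n − t_{n−1}): the construction is the printed one («a sequence of maximal domains … Ω_n is a
union of LⁿξM₁-cubes, and dist(Ω_n, Ωᶜ_{n−1}) ≧ LⁿξM₁», [Balaban1988Convergent] p. 256); its closed form along a flat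
face — any `t : ℕ → ℤ` with `t 0 = 0`, `t 1 = LM₁`, `t (n+2) = 2L^{n+2}M₁` — is certified below: grid alignment,
printed separation, and a maximality certificate (the next grid position fails the separation). -/

/-- «Ω_n is a union of LⁿξM₁-cubes»: every face coordinate of the closed form is on its grid. [folklore] -/
theorem tFlat_aligned (L M₁ : ℤ) (t : ℕ → ℤ) (h0 : t 0 = 0) (h1 : t 1 = L * M₁)
    (h2 : ∀ n, t (n + 2) = 2 * (L ^ (n + 2) * M₁)) : ∀ n : ℕ, (L ^ n * M₁) ∣ t n
  | 0 => by rw [h0]; exact dvd_zero _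
  | 1 => by rw [h1, pow_one]
  | (n + 2) => by rw [h2]; exact dvd_mul_left _ _

/-- «dist(Ω_n, Ωᶜ_{n−1}) ≧ LⁿξM₁»: the closed form satisfies the printed separation (L ≥ 2, M₁ ≥ 0). [folklore] -/
theorem tFlat_sep (L M₁ : ℤ) (hL : 2 ≤ L) (hM : 0 ≤ M₁) (t : ℕ → ℤ) (h0 : t 0 = 0) (h1 : t 1 = L * M₁)
    (h2 : ∀ n, t (n + 2) = 2 * (L ^ (n + 2) * M₁)) :
    ∀ n : ℕ, L ^ (n + 1) * M₁ ≤ t (n + 1) - t n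
  | 0 => by rw [h1, h0, pow_one]; linarith
  | 1 => by
      have hLM : 0 ≤ L * M₁ := mul_nonneg (by linarith) hM
      rw [show (1:ℕ) + 1 = 0 + 2 from rfl, h2, h1]
      show L ^ 2 * M₁ ≤ 2 * (L ^ 2 * M₁) - L * M₁
      nlinarith [mul_nonneg hLM (show (0:ℤ) ≤ L - 1 by linarith)]
  | (n + 2) => by
      have hP : 0 ≤ L ^ (n + 2) * M₁ := mul_nonneg (pow_nonneg (by linarith) _) hM
      have e3 : L ^ (n + 2 + 1) = L ^ (n + 2) * L := pow_succ L (n + 2)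
      rw [show n + 2 + 1 = (n + 1) + 2 from rfl, h2, h2, show (n + 1) + 2 = n + 2 + 1 from rfl, e3]
      nlinarith [mul_nonneg hP (show (0:ℤ) ≤ L - 2 by linarith)]

/-- MAXIMALITY CERTIFICATE: the next grid position one cube further out, t_{n+1} − L^{n+1}M₁, violates the printed
separation — so the closed form is the maximal admissible choice at every step (L ≥ 1, M₁ > 0). [folklore] -/
theorem tFlat_maximal (L M₁ : ℤ) (hL : 1 ≤ L) (hM : 0 < M₁) (t : ℕ → ℤ) (h0 : t 0 = 0) (h1 : t 1 = L * M₁)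
    (h2 : ∀ n, t (n + 2) = 2 * (L ^ (n + 2) * M₁)) :
    ∀ n : ℕ, (t (n + 1) - L ^ (n + 1) * M₁) - t n < L ^ (n + 1) * M₁
  | 0 => by
      have : 0 < L * M₁ := mul_pos (by linarith) hM
      rw [h1, h0, pow_one]; linarith
  | 1 => by
      have : 0 < L * M₁ := mul_pos (by linarith) hM
      rw [show (1:ℕ) + 1 = 0 + 2 from rfl, h2, h1]
      show (2 * (L ^ 2 * M₁) - L ^ 2 * M₁) - L * M₁ < L ^ 2 * M₁
      linarith
  | (n + 2) => by
      have hP : 0 < L ^ (n + 2) * M₁ := mul_pos (pow_pos (by linarith) _) hM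
      have e3 : L ^ (n + 2 + 1) = L ^ (n + 2) * L := pow_succ L (n + 2)
      rw [show n + 2 + 1 = (n + 1) + 2 from rfl, h2, h2, show (n + 1) + 2 = n + 2 + 1 from rfl, e3]
      nlinarith

/-- B14 «dist(Ω_j, Ωᶜ) ≦ 2M₁» is ATTAINED on a flat face (t_j = 2·LʲM₁ fine units = 2M₁ level-j units, j ≥ 2), and the
sub-top layer Ω_{j−1}∖Ω_j is 2(L−1)·L^{j−1}M₁ fine units thick (j = n + 3 ≥ 3), i.e. 2(L−1) ∈ [L, 2L) level-(j−1)
M₁-blocks. [folklore] -/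
theorem tFlat_layer (L M₁ : ℤ) (t : ℕ → ℤ) (h2 : ∀ n, t (n + 2) = 2 * (L ^ (n + 2) * M₁)) (n : ℕ) :
    t (n + 3) - t (n + 2) = 2 * (L - 1) * (L ^ (n + 2) * M₁) := by
  have e3 : L ^ (n + 1 + 2) = L ^ (n + 2) * L := pow_succ L (n + 2)
  rw [show n + 3 = (n + 1) + 2 from rfl, h2, h2, e3]
  ring

/-- REALIZED SHORTFALL on the flat maximal nest (j = n + 3): the clause needs the sub-top layer to contain the outward
collar 2R₁LʲM₁ of a boundary block; the layer is 2(L−1)L^{j−1}M₁; exactly R₁·L·layer = (L−1)·needed, i.e.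
needed/layer = R₁L/(L−1) > 1 for every L ≥ 2, R₁ ≥ 1. [folklore] -/
theorem realized_shortfall (L M₁ R₁ : ℤ) (t : ℕ → ℤ) (h2 : ∀ n, t (n + 2) = 2 * (L ^ (n + 2) * M₁)) (n : ℕ) :
    R₁ * L * (t (n + 3) - t (n + 2)) = (L - 1) * (2 * R₁ * (L ^ (n + 3) * M₁)) := by
  rw [tFlat_layer L M₁ t h2 n, show L ^ (n + 3) = L ^ (n + 2) * L from pow_succ L (n + 2)]
  ring

/-- On the flat maximal nest the sub-top layer is STRICTLY thinner than the needed collar, for every L ≥ 2, M₁ > 0,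
R₁ ≥ 1. [folklore] -/
theorem needed_gt_layer (L M₁ R₁ : ℤ) (hL : 2 ≤ L) (hM : 0 < M₁) (hR : 1 ≤ R₁) (t : ℕ → ℤ)
    (h2 : ∀ n, t (n + 2) = 2 * (L ^ (n + 2) * M₁)) (n : ℕ) :
    t (n + 3) - t (n + 2) < 2 * R₁ * (L ^ (n + 3) * M₁) := by
  have hP : 0 < L ^ (n + 2) * M₁ := mul_pos (pow_pos (by linarith) _) hM
  rw [tFlat_layer L M₁ t h2 n, show L ^ (n + 3) = L ^ (n + 2) * L from pow_succ L (n + 2)]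
  nlinarith [mul_nonneg (mul_nonneg (show (0:ℤ) ≤ R₁ - 1 by linarith) (show (0:ℤ) ≤ L by linarith)) hP.le]

/-! ## §5  The separation-constant reading of «short by a factor ≥ 2 for every parameter choice» -/

/-- A maximal κ-separated step at a flat face: t is the least grid point (grid u) with t − tm ≥ κu, so the previous grid
point fails: (t − u) − tm < κu; hence the layer t − tm is < (κ+1)u. [folklore] -/
theorem layer_lt_of_maximal (t tm u κ : ℤ) (hmax : (t - u) - tm < κ * u) : t - tm < (κ + 1) * u := by
  linarith

/-- If the sub-top layer must contain the outward collar 2R₁·u (u = LʲM₁ fine units) of a boundary block and is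
< (κ+1)u thick, then κ ≥ 2R₁: against the PRINTED κ = 1 the separation constant is short by the factor ≥ 2R₁ ≥ 2 for
every parameter choice.  (`hneed` «2R₁u ≤ layer»: the witness of `sectF_tilde_not_subset_prev` gives layer ≥ 2R₁u − 1,
upgraded to ≥ 2R₁u by grid alignment — layer and 2R₁u are multiples of L^{j−1}M₁ ≥ 2; module header item (4).)
[folklore] -/
theorem kappa_needed (κ R₁ u layer : ℤ) (hu : 0 < u) (hneed : 2 * R₁ * u ≤ layer)
    (hmax : layer < (κ + 1) * u) : 2 * R₁ ≤ κ := by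
  have h : 2 * R₁ * u < (κ + 1) * u := lt_of_le_of_lt hneed hmax
  have h' : 2 * R₁ < κ + 1 := lt_of_mul_lt_mul_right h hu.le
  linarith

/-- The printed constant κ = 1 never suffices (R₁ ≥ 1). [folklore] -/
theorem printed_kappa_fails (R₁ u layer : ℤ) (hR : 1 ≤ R₁) (hu : 0 < u) (hmax : layer < (1 + 1) * u) :
    ¬ 2 * R₁ * u ≤ layer := fun hneed => by
  have := kappa_needed 1 R₁ u layer hu hneed hmax
  linarith

end Literature.MathematicalPhysics.QuantumFieldTheory.Balaban1983to89.B11SectFCoverage
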